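import Mathlib
import Summits.ValiantsHypothesis.ValiantsHypothesis.Theses.LiouvilleSarnak
import Summits.ValiantsHypothesis.ValiantsHypothesis.Theorems.LiouvilleSarnakDigitalBilinearLiouvilleCoarseVectors
import Literature.NumberTheory.LFunctions.SiegelWalfiszLiouville
import Literature.NumberTheory.LFunctions.SiegelWalfiszMoebiusProofs

/-!
# Route LiouvilleSarnak — crux `DigitalBilinearLiouville` (stmt-ValiantsHypothesis-14774):
# the crux HOLDS for PERIODIC (low-digit) test vectors, under every cut (unconditional)

Companion of `Theorems/LiouvilleSarnakDigitalBilinearLiouvilleCoarseVectors.lean` (test vectors blind to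
the LOW `L(ε)` digits: Matomäki–Radziwiłł).  Here the opposite end: test vectors that see ONLY the lowest
`L₁` digits (`u(r)` a function of the row digits at positions `< L₁`, `w(c)` of the column digits at
positions `< L₁`).  On the number side the weight is then `2^{L₁}`-PERIODIC, the bilinear form is a
combination of `2^{L₁}` sums of `λ` over arithmetic progressions modulo `2^{L₁}` of length `4^n/2^{L₁}`,
and Siegel–Walfisz (tree: `SiegelWalfiszMoebius_holds.liouville_progression`, PROVED) makes each of them
`O(4^n / log 4^n)`:

* `sum_liouville_ap_eq_filter` — `Σ_{H < B} λ(q H + a + 1)` is the Siegel–Walfisz progression sum over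
  `{n' ∈ [1, qB] : n' ≡ a + 1 (mod q)}`.
* ★ `digitalBilinear_periodic` — for every `L₁` and `ε > 0` there is `n₀` such that for all `n ≥ n₀`,
  every balanced cut `π` and all `L₁`-periodic test vectors `u, w`,
  `‖Σ_r Σ_c u(r) w(c) λ(N_π(r,c)+1)‖² ≤ ε · 4^n · (Σ‖u‖²)(Σ‖w‖²)`.

With the coarse family this brackets the crux: test vectors factoring through the TOP digits (MR) or
through the BOTTOM `O(1)` digits (Siegel–Walfisz) are fine under every cut; the open content is the
genuinely MIXED dependence (already for the aligned cut: `AlignedTypeI`, stmt-21040).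
Honest framing: unconditional partial result; `DigitalBilinearLiouville`, `LiouvilleCutRank`,
`AlgebraicSarnak` stay OPEN; nothing here bears on VP versus VNP.  No definitions.
-/

-- the directory `ValiantsHypothesis/ValiantsHypothesis` repeats the summit name (tree layout)
set_option linter.dupNamespace false

namespace Summit.ValiantsHypothesis.ValiantsHypothesis.Theorems.LiouvilleSarnakDigitalBilinearLiouville.Coarse

open Finset ArithmeticFunction
open Literature.NumberTheory.LFunctions (SiegelWalfiszMoebius_holds)

/-- The progression sum `Σ_{H < B} λ(q H + a + 1)` (`a < q`) equals the Siegel–Walfisz sum of `λ` over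
`{n' ∈ [1, q B] : n' ≡ a + 1 (mod q)}`. [folklore] -/
theorem sum_liouville_ap_eq_filter (q B a : ℕ) (hq : 0 < q) (ha : a < q) :
    ∑ H ∈ range B, (liouville (q * H + a + 1) : ℝ) =
      ∑ n' ∈ (Icc 1 (q * B)).filter (fun n' : ℕ => (n' : ZMod q) = ((a + 1 : ℕ) : ZMod q)),
        (liouville n' : ℝ) := by
  classical
  have himage : (Icc 1 (q * B)).filter (fun n' : ℕ => (n' : ZMod q) = ((a + 1 : ℕ) : ZMod q)) =
      (range B).image fun H => q * H + a + 1 := by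
    ext n'
    simp only [mem_filter, mem_Icc, mem_image, mem_range]
    constructor
    · rintro ⟨⟨h1, h2⟩, h3⟩
      have hmod : n' % q = (a + 1) % q := (ZMod.natCast_eq_natCast_iff' _ _ _).mp h3
      refine ⟨(n' - 1) / q, ?_, ?_⟩
      · rw [Nat.div_lt_iff_lt_mul hq]; rw [Nat.mul_comm] ; omega
      · -- `n' - 1 ≡ a (mod q)` and `a < q`
        have hm : (n' - 1) % q = a := by
          have h4 : (n' - 1 + 1) % q = (a + 1) % q := by rw [Nat.sub_add_cancel h1]; exact hmod
          have h5 : (n' - 1) % q = a % q := by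
            have := Nat.ModEq.add_right_cancel' 1 (h4 : (n' - 1 + 1) ≡ (a + 1) [MOD q])
            exact this
          rw [h5, Nat.mod_eq_of_lt ha]
        have h6 := Nat.div_add_mod (n' - 1) q
        omega
    · rintro ⟨H, hH, rfl⟩
      refine ⟨⟨by omega, ?_⟩, ?_⟩
      · calc q * H + a + 1 ≤ q * H + q := by omega
          _ = q * (H + 1) := by ring
          _ ≤ q * B := Nat.mul_le_mul_left q hH
      · rw [ZMod.natCast_eq_natCast_iff']
        rw [Nat.add_assoc, Nat.mul_add_mod]
  rw [himage, sum_image]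
  intro H _ H' _ h
  simp only at h
  exact Nat.eq_of_mul_eq_mul_left hq (by omega : q * H = q * H')

/-- ★ **`DigitalBilinearLiouville` for periodic (low-digit) test vectors, unconditionally and for every
cut.**  For every `L₁` and every `ε > 0` there is `n₀` such that for all `n ≥ n₀`, every balanced cut
`π` of the `2n` positions and all `u, w : {0,1}^n → ℂ` with `u(r)` a function of the row digits at
positions `< L₁` only and `w(c)` a function of the column digits at positions `< L₁` only,
`‖Σ_r Σ_c u(r) w(c) λ(N_π(r,c) + 1)‖² ≤ ε · 4^n · (Σ_r ‖u r‖²) · (Σ_c ‖w c‖²)`.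
[cite: MontgomeryVaughan2007, §11.3 Exercises 8 and 13(f)] -/
theorem digitalBilinear_periodic (L₁ : ℕ) :
    ∀ ε : ℝ, 0 < ε → ∃ n₀ : ℕ, ∀ n : ℕ, n₀ ≤ n → ∀ π : Fin n ⊕ Fin n ≃ Fin (2 * n),
      ∀ u w : (Fin n → Bool) → ℂ,
        (∀ r r' : Fin n → Bool, (∀ i : Fin n, (π (Sum.inl i) : ℕ) < L₁ → r' i = r i) → u r' = u r) →
        (∀ c c' : Fin n → Bool, (∀ i : Fin n, (π (Sum.inr i) : ℕ) < L₁ → c' i = c i) → w c' = w c) →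
        ‖∑ r : Fin n → Bool, ∑ c : Fin n → Bool, u r * w c *
            ((liouville (Nat.ofBits (fun j : Fin (2 * n) => Sum.elim r c (π.symm j)) + 1) : ℤ) : ℂ)‖ ^ 2
          ≤ ε * 4 ^ n * (∑ r : Fin n → Bool, ‖u r‖ ^ 2) * (∑ c : Fin n → Bool, ‖w c‖ ^ 2) := by
  classical
  intro ε hε
  obtain ⟨C, hC⟩ := SiegelWalfiszMoebius_holds.liouville_progression (A := 1) one_pos 1
  -- threshold: `n ≥ 2^{L₁}` (modulus in the Siegel–Walfisz range, `L₁ ≤ 2n`) and `q² C² ≤ ε n²`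
  obtain ⟨n₁, hn₁⟩ := exists_nat_ge ((2 : ℝ) ^ L₁ * (2 : ℝ) ^ L₁ * C ^ 2 / ε)
  refine ⟨max (2 ^ L₁) (n₁ + 1), fun n hn π u w hu hw => ?_⟩
  have hnq : 2 ^ L₁ ≤ n := le_trans (le_max_left _ _) hn
  have hn1 : n₁ + 1 ≤ n := le_trans (le_max_right _ _) hn
  have hLn : L₁ ≤ 2 * n := by have := Nat.lt_two_pow_self (n := L₁); omega
  have hnpos : 0 < n := by have := Nat.one_le_two_pow (n := L₁); omega
  have hqpos : 0 < 2 ^ L₁ := Nat.two_pow_pos L₁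
  have hqB : 2 ^ L₁ * 2 ^ (2 * n - L₁) = 2 ^ (2 * n) := by rw [← pow_add]; congr 1; omega
  -- the weight on the number side; it is `2^{L₁}`-periodic
  set Q : ℕ → (Fin n → Bool) × (Fin n → Bool) := fun m =>
    (fun i => m.testBit (π (Sum.inl i)), fun i => m.testBit (π (Sum.inr i))) with hQ
  set g : ℕ → ℂ := fun m => u (Q m).1 * w (Q m).2 with hg
  have hper : ∀ H a : ℕ, a < 2 ^ L₁ → g (2 ^ L₁ * H + a) = g a := by
    intro H a ha
    have hbit : ∀ j : ℕ, j < L₁ → (2 ^ L₁ * H + a).testBit j = a.testBit j := by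
      intro j hj
      rw [Nat.testBit_two_pow_mul_add _ ha, if_pos hj]
    have h1 : u (Q (2 ^ L₁ * H + a)).1 = u (Q a).1 :=
      hu _ _ fun i hi => by simp only [hQ]; exact hbit _ hi
    have h2 : w (Q (2 ^ L₁ * H + a)).2 = w (Q a).2 :=
      hw _ _ fun i hi => by simp only [hQ]; exact hbit _ hi
    simp only [hg, h1, h2]
  -- the progression sums
  set A : ℕ → ℝ := fun a => ∑ H ∈ range (2 ^ (2 * n - L₁)), (liouville (2 ^ L₁ * H + a + 1) : ℝ)
    with hA
  -- Step 1: re-index and group by residues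
  have hstep1 : ∑ r : Fin n → Bool, ∑ c : Fin n → Bool, u r * w c *
      ((liouville (Nat.ofBits (fun j : Fin (2 * n) => Sum.elim r c (π.symm j)) + 1) : ℤ) : ℂ) =
      ∑ a ∈ range (2 ^ L₁), g a * (A a : ℂ) := by
    rw [← Fintype.sum_prod_type' (f := fun r c => u r * w c *
      ((liouville (Nat.ofBits (fun j : Fin (2 * n) => Sum.elim r c (π.symm j)) + 1) : ℤ) : ℂ))]
    rw [sum_pairs_eq_sum_range n π, ← hqB, sum_range_mul_eq_sum_sum (2 ^ L₁) (2 ^ (2 * n - L₁)) hqpos,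
      sum_comm]
    refine sum_congr rfl fun a ha => ?_
    rw [hA]
    push_cast
    rw [mul_sum]
    refine sum_congr rfl fun H hH => ?_
    have hm : 2 ^ L₁ * H + a < 2 ^ (2 * n) := by
      rw [← hqB]
      calc 2 ^ L₁ * H + a < 2 ^ L₁ * H + 2 ^ L₁ := by have := mem_range.mp ha; omega
        _ = 2 ^ L₁ * (H + 1) := by ring
        _ ≤ 2 ^ L₁ * 2 ^ (2 * n - L₁) := Nat.mul_le_mul_left _ (mem_range.mp hH)
    have hNQ : (Nat.ofBits (fun j : Fin (2 * n) =>
        Sum.elim (Q (2 ^ L₁ * H + a)).1 (Q (2 ^ L₁ * H + a)).2 (π.symm j))) = 2 ^ L₁ * H + a := by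
      have hfun : (fun j : Fin (2 * n) =>
          Sum.elim (Q (2 ^ L₁ * H + a)).1 (Q (2 ^ L₁ * H + a)).2 (π.symm j)) =
          fun j : Fin (2 * n) => (2 ^ L₁ * H + a).testBit j := by
        funext j
        rcases h : π.symm j with k | k
        · have hk : π (Sum.inl k) = j := by rw [← h, Equiv.apply_symm_apply]
          simp [hQ, hk]
        · have hk : π (Sum.inr k) = j := by rw [← h, Equiv.apply_symm_apply]
          simp [hQ, hk]
      rw [hfun]
      apply Nat.eq_of_testBit_eq
      intro j
      by_cases hj : j < 2 * n
      · rw [Nat.testBit_ofBits_lt _ _ hj]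
      · rw [Nat.testBit_ofBits_ge _ _ (not_lt.mp hj), Nat.testBit_lt_two_pow]
        exact hm.trans_le (Nat.pow_le_pow_right Nat.two_pos (not_lt.mp hj))
    rw [hNQ, ← hper H a (mem_range.mp ha)]
  -- Step 2: Cauchy–Schwarz
  have hCS : ‖∑ a ∈ range (2 ^ L₁), g a * (A a : ℂ)‖ ^ 2 ≤
      (∑ a ∈ range (2 ^ L₁), ‖g a‖ ^ 2) * (∑ a ∈ range (2 ^ L₁), A a ^ 2) := by
    have h1 : ‖∑ a ∈ range (2 ^ L₁), g a * (A a : ℂ)‖ ≤ ∑ a ∈ range (2 ^ L₁), ‖g a‖ * |A a| := by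
      refine (norm_sum_le _ _).trans (le_of_eq ?_)
      refine sum_congr rfl fun a _ => ?_
      rw [norm_mul, Complex.norm_real, Real.norm_eq_abs]
    have h2 := Finset.sum_mul_sq_le_sq_mul_sq (range (2 ^ L₁)) (fun a => ‖g a‖) (fun a => |A a|)
    calc ‖∑ a ∈ range (2 ^ L₁), g a * (A a : ℂ)‖ ^ 2
        ≤ (∑ a ∈ range (2 ^ L₁), ‖g a‖ * |A a|) ^ 2 := pow_le_pow_left₀ (norm_nonneg _) h1 2
      _ ≤ (∑ a ∈ range (2 ^ L₁), ‖g a‖ ^ 2) * (∑ a ∈ range (2 ^ L₁), |A a| ^ 2) := h2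
      _ = _ := by simp only [sq_abs]
  -- Step 3: `2^{2n-L₁} · Σ_a ‖g a‖² = ‖u‖² ‖w‖²`
  have hgsum : (2 : ℝ) ^ (2 * n - L₁) * ∑ a ∈ range (2 ^ L₁), ‖g a‖ ^ 2 =
      (∑ r : Fin n → Bool, ‖u r‖ ^ 2) * (∑ c : Fin n → Bool, ‖w c‖ ^ 2) := by
    have h1 : (∑ r : Fin n → Bool, ‖u r‖ ^ 2) * (∑ c : Fin n → Bool, ‖w c‖ ^ 2) =
        ∑ p : (Fin n → Bool) × (Fin n → Bool), ‖u p.1 * w p.2‖ ^ 2 := by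
      rw [sum_mul_sum, ← Fintype.sum_prod_type']
      refine Fintype.sum_congr _ _ fun p => ?_
      rw [norm_mul, mul_pow]
    rw [h1, sum_pairs_eq_sum_range n π, ← hqB,
      sum_range_mul_eq_sum_sum (2 ^ L₁) (2 ^ (2 * n - L₁)) hqpos]
    have : ∀ H ∈ range (2 ^ (2 * n - L₁)), ∑ a ∈ range (2 ^ L₁),
        ‖u (Q (2 ^ L₁ * H + a)).1 * w (Q (2 ^ L₁ * H + a)).2‖ ^ 2 = ∑ a ∈ range (2 ^ L₁), ‖g a‖ ^ 2 := by
      intro H _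
      refine sum_congr rfl fun a ha => ?_
      rw [← hper H a (mem_range.mp ha)]
    rw [sum_congr rfl this, sum_const, card_range, nsmul_eq_mul]
    push_cast
    ring
  -- Step 4: Siegel–Walfisz on each progression: `|A a| ≤ C 4^n / log 4^n ≤ C 4^n / n`
  have hx2 : (2 : ℝ) ≤ (4 : ℝ) ^ n := by
    calc (2 : ℝ) ≤ 4 ^ 1 := by norm_num
      _ ≤ 4 ^ n := pow_le_pow_right₀ (by norm_num) hnpos
  have hlog4 : (n : ℝ) ≤ Real.log ((4 : ℝ) ^ n) := by
    rw [Real.log_pow]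
    have h4 : (1 : ℝ) ≤ Real.log 4 := by
      have := Real.log_two_gt_d9
      have h : Real.log 4 = 2 * Real.log 2 := by
        rw [show (4 : ℝ) = 2 ^ 2 by norm_num, Real.log_pow]; norm_num
      rw [h]; linarith
    nlinarith
  have hApr : ∀ a ∈ range (2 ^ L₁), |A a| ≤ C * (4 : ℝ) ^ n / n := by
    intro a ha
    have hq1 : (1 : ℕ) ≤ 2 ^ L₁ := hqpos
    have hqlog : ((2 ^ L₁ : ℕ) : ℝ) ≤ Real.log ((4 : ℝ) ^ n) ^ (1 : ℝ) := by
      rw [Real.rpow_one]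
      exact le_trans (by exact_mod_cast hnq) hlog4
    have hSW := hC ((4 : ℝ) ^ n) hx2 (2 ^ L₁) hq1 hqlog (((a + 1 : ℕ) : ZMod (2 ^ L₁)))
    have hfloor : ⌊(4 : ℝ) ^ n⌋₊ = 2 ^ L₁ * 2 ^ (2 * n - L₁) := by
      rw [hqB, show (4 : ℝ) ^ n = ((2 ^ (2 * n) : ℕ) : ℝ) by push_cast; rw [pow_mul]; norm_num,
        Nat.floor_natCast]
    rw [hfloor, ← sum_liouville_ap_eq_filter (2 ^ L₁) (2 ^ (2 * n - L₁)) a hqpos (mem_range.mp ha),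
      Real.rpow_one] at hSW
    refine hSW.trans ?_
    have hn' : (0 : ℝ) < n := by exact_mod_cast hnpos
    have hC0 : 0 ≤ C := by
      have := (abs_nonneg _).trans hSW
      have hpos : (0 : ℝ) < (4 : ℝ) ^ n / Real.log ((4 : ℝ) ^ n) := by
        apply div_pos (by positivity); linarith
      by_contra hneg
      push Not at hneg
      have : C * (4 : ℝ) ^ n / Real.log ((4 : ℝ) ^ n) < 0 := by
        rw [mul_div_assoc]; exact mul_neg_of_neg_of_pos hneg hpos
      linarith
    rw [mul_div_assoc, mul_div_assoc]
    refine mul_le_mul_of_nonneg_left ?_ hC0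
    exact div_le_div_of_nonneg_left (by positivity) hn' hlog4
  have hAsq : ∑ a ∈ range (2 ^ L₁), A a ^ 2 ≤ (2 : ℝ) ^ L₁ * (C * (4 : ℝ) ^ n / n) ^ 2 := by
    calc ∑ a ∈ range (2 ^ L₁), A a ^ 2 ≤ ∑ a ∈ range (2 ^ L₁), (C * (4 : ℝ) ^ n / n) ^ 2 := by
          refine sum_le_sum fun a ha => ?_
          rw [← sq_abs]
          exact pow_le_pow_left₀ (abs_nonneg _) (hApr a ha) 2
      _ = _ := by rw [sum_const, card_range, nsmul_eq_mul]; push_cast; ring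
  -- assemble: `‖Σ‖² ≤ (‖u‖²‖w‖² / 2^{2n-L₁}) · 2^{L₁} C² 16^n / n² = (2^{L₁})² C² / n² · 4^n ‖u‖²‖w‖²`
  have hB0 : (0 : ℝ) < (2 : ℝ) ^ (2 * n - L₁) := by positivity
  have hn' : (0 : ℝ) < n := by exact_mod_cast hnpos
  have hqBr : (2 : ℝ) ^ L₁ * (2 : ℝ) ^ (2 * n - L₁) = (4 : ℝ) ^ n := by
    rw [← pow_add, show L₁ + (2 * n - L₁) = 2 * n by omega, pow_mul]; norm_num
  have hsmall : (2 : ℝ) ^ L₁ * (2 : ℝ) ^ L₁ * C ^ 2 ≤ ε * (n : ℝ) ^ 2 := by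
    have h1 : (2 : ℝ) ^ L₁ * (2 : ℝ) ^ L₁ * C ^ 2 / ε ≤ n := by
      refine hn₁.trans ?_
      exact_mod_cast (by omega : n₁ ≤ n)
    rw [div_le_iff₀ hε] at h1
    have hn1' : (1 : ℝ) ≤ n := by exact_mod_cast hnpos
    have hn0 : (0 : ℝ) ≤ n := by positivity
    have h2 : (n : ℝ) * ε ≤ ε * (n : ℝ) ^ 2 := by
      have h3 : 0 ≤ ε * (n : ℝ) * ((n : ℝ) - 1) := mul_nonneg (mul_nonneg hε.le hn0) (by linarith)
      nlinarith [h3]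
    exact h1.trans h2
  rw [hstep1]
  set U : ℝ := (∑ r : Fin n → Bool, ‖u r‖ ^ 2) * (∑ c : Fin n → Bool, ‖w c‖ ^ 2) with hU
  have hU0 : 0 ≤ U := by positivity
  have hgsum' : ∑ a ∈ range (2 ^ L₁), ‖g a‖ ^ 2 = U / (2 : ℝ) ^ (2 * n - L₁) := by
    rw [eq_div_iff hB0.ne', mul_comm, hgsum]
  calc ‖∑ a ∈ range (2 ^ L₁), g a * (A a : ℂ)‖ ^ 2
      ≤ (∑ a ∈ range (2 ^ L₁), ‖g a‖ ^ 2) * (∑ a ∈ range (2 ^ L₁), A a ^ 2) := hCS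
    _ ≤ (U / (2 : ℝ) ^ (2 * n - L₁)) * ((2 : ℝ) ^ L₁ * (C * (4 : ℝ) ^ n / n) ^ 2) := by
        rw [hgsum']
        exact mul_le_mul_of_nonneg_left hAsq (by positivity)
    _ = ((2 : ℝ) ^ L₁ * (2 : ℝ) ^ L₁ * C ^ 2) / (n : ℝ) ^ 2 * (4 : ℝ) ^ n * U *
          ((4 : ℝ) ^ n / ((2 : ℝ) ^ L₁ * (2 : ℝ) ^ (2 * n - L₁))) := by
        field_simp
    _ = ((2 : ℝ) ^ L₁ * (2 : ℝ) ^ L₁ * C ^ 2) / (n : ℝ) ^ 2 * (4 : ℝ) ^ n * U := by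
        rw [hqBr, div_self (by positivity), mul_one]
    _ ≤ ε * (4 : ℝ) ^ n * U := by
        have h1 : ((2 : ℝ) ^ L₁ * (2 : ℝ) ^ L₁ * C ^ 2) / (n : ℝ) ^ 2 ≤ ε := by
          rw [div_le_iff₀ (by positivity)]; exact hsmall
        have h2 : 0 ≤ (4 : ℝ) ^ n * U := by positivity
        nlinarith
    _ = ε * 4 ^ n * (∑ r : Fin n → Bool, ‖u r‖ ^ 2) * (∑ c : Fin n → Bool, ‖w c‖ ^ 2) := by
        rw [hU]; ring

end Summit.ValiantsHypothesis.ValiantsHypothesis.Theorems.LiouvilleSarnakDigitalBilinearLiouville.Coarse
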